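import Literature.Computability.Complexity.CodeFPListKit
import Literature.Computability.Complexity.CodeFPBudgets
import Literature.Computability.Complexity.CodeFPLists
import Literature.Computability.Complexity.CodeFPStrings
import Literature.Computability.Complexity.CookBridges
import Summits.PneNP.PneNP.Theorems.SignDeg2AvoidAffineSplitFP
import Summits.PneNP.PneNP.Theorems.PstarPairPeelFPCorrect

/-!
# F4-FP, part 3/3: polynomial time, and the support theorem `pstarPairsReduction`

Cell pnp-ideate, ROUND-18 notes §F4 (support item «PstarPairsReduction» of the `SignDeg2Avoid` packet).  The
pair-peeling machine `ppStr f₀` of part 1 is a `CodeFP` program (decode at locality `4`, a `findIdx` per output for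
its hub, a filter, the derived code assembled with `AffineSplitFP.blk`, ONE call of the hypothesised `f₀`, a scatter)
— hence polynomial time when `f₀` is; with part 2 this proves

  `pstarPairsReduction : SignDeg2OnlyAvoidLinearFP 4 → ∃ C', LocalAvoidLinearFP 4
      (fun n _ I => (∀ j, I.table j = xorAndPred) ∧ Nonempty (PstarPairPeel.Pairing I (C' * n)))`  (`C' = C₀`):

GIVEN an FP range-avoider at linear stretch for the sign-degree-≤2 `4`-local maps (ROUND-18 crux K1 at `k = 4`),
the `P⋆ = x₀ ⊕ x₁ ⊕ x₂x₃` instances with a repeated-XOR-slot pairing of size `C₀·n` are avoided in FP.  Conditional,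
restricted-model reduction step of the range-avoidance ladder; it says nothing about `P` versus `NP`.
-/

set_option linter.dupNamespace false -- `Summit.PneNP.PneNP.…`: summit = sub-problem name (D-0017 single-conjunct layout)

namespace Summit.PneNP.PneNP.Theorems.PstarPairPeelFP

open Literature.Computability.Complexity
open Summit.PneNP.PneNP.Theorems.LocalMapDecodeFP (decode hdrN outE codeFP_decode codeFP_hdrN)
open Summit.PneNP.PneNP.Theorems.AffineSplitFP (blk codeFP_blk codeFP_unaryCode)
open Summit.PneNP.PneNP.Theorems.PstarPairPeel (Pairing)

section PolyTime

open CodeFP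

/-- Code of a row list. -/
abbrev rowsE : List (List ℕ) → List Bool := rawE (rawE natE)

/-- The XOR-slot key is polynomial time. -/
theorem codeFP_key : CodeFP (rawE natE) (pairE natE natE) key :=
  (((rawGetD natE (d := 0) natE_zero).comp ((CodeFP.id (rawE natE)).pair (const _ ((0 : Fin 4).val)))).pair
    ((rawGetD natE (d := 0) natE_zero).comp ((CodeFP.id (rawE natE)).pair (const _ ((1 : Fin 4).val))))).congr
    fun _ => rfl

/-- The hub of an output is polynomial time (a `findIdx` over the rows). -/
theorem codeFP_hubOf : CodeFP (pairE rowsE natE) natE (fun q => hubOf q.1 q.2) := by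
  have hrow : CodeFP (pairE rowsE natE) (rawE natE) (fun q => q.1.getD q.2 []) := rawGetD (rawE natE) (d := []) rfl
  have hkey : CodeFP (pairE rowsE natE) (pairE natE natE) (fun q => key (q.1.getD q.2 [])) := codeFP_key.comp hrow
  have hp : CodeFP (pairE (pairE natE natE) (rawE natE)) bitE (fun t => key t.2 == t.1) :=
    (beq (pairE_injective natE_injective natE_injective)).comp ((codeFP_key.comp (snd _ _)).pair (fst _ _))
  exact ((findIdxFP hp).comp (hkey.pair (fst rowsE natE))).congr fun _ => rfl

/-- The list of non-hub outputs is polynomial time. -/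
theorem codeFP_fsts : CodeFP rowsE (rawE natE) fsts := by
  have hp : CodeFP (pairE rowsE natE) bitE (fun q => !(hubOf q.1 q.2 == q.2)) :=
    ((beq natE_injective).comp (codeFP_hubOf.pair (snd rowsE natE))).not
  have hrange : CodeFP rowsE (rawE natE) (fun rows => List.range rows.length) := urange.comp (ulength (rawE natE))
  exact ((filter hp).comp ((CodeFP.id rowsE).pair hrange)).congr fun _ => rfl

/-- An entry of a row of the list is polynomial time. -/
theorem codeFP_entry (c : ℕ) : CodeFP (pairE rowsE natE) natE (fun q => (q.1.getD q.2 []).getD c 0) :=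
  ((rawGetD natE (d := 0) natE_zero).comp ((rawGetD (rawE natE) (d := []) rfl).pair (const _ c))).congr fun _ => rfl

/-- The decoded derived output is polynomial time. -/
theorem codeFP_peelOut : CodeFP (pairE rowsE natE) outE (fun q => peelOut q.1 q.2) := by
  have hh : CodeFP (pairE rowsE natE) (pairE rowsE natE) (fun q => (q.1, hubOf q.1 q.2)) := (fst rowsE natE).pair codeFP_hubOf
  have e1 := codeFP_entry (2 : Fin 4).val
  have e2 := codeFP_entry (3 : Fin 4).val
  have e3 : CodeFP (pairE rowsE natE) natE (fun q => (q.1.getD (hubOf q.1 q.2) []).getD (2 : Fin 4).val 0) :=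
    ((codeFP_entry (2 : Fin 4).val).comp hh).congr fun _ => rfl
  have e4 : CodeFP (pairE rowsE natE) natE (fun q => (q.1.getD (hubOf q.1 q.2) []).getD (3 : Fin 4).val 0) :=
    ((codeFP_entry (3 : Fin 4).val).comp hh).congr fun _ => rfl
  have hl : CodeFP (pairE rowsE natE) (rawE natE) (fun q => [(q.1.getD q.2 []).getD (2 : Fin 4).val 0,
      (q.1.getD q.2 []).getD (3 : Fin 4).val 0, (q.1.getD (hubOf q.1 q.2) []).getD (2 : Fin 4).val 0,
      (q.1.getD (hubOf q.1 q.2) []).getD (3 : Fin 4).val 0]) :=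
    ((rawCons natE).comp (e1.pair ((rawCons natE).comp (e2.pair ((rawCons natE).comp (e3.pair
      ((rawSingleton natE).comp e4))))))).congr fun _ => rfl
  exact ((const _ ipTab).pair hl).congr fun _ => rfl

/-- The derived code is polynomial time. -/
theorem codeFP_peelCode : CodeFP (pairE unE rowsE) strE (fun q => peelCode q.1 q.2) := by
  have hf : CodeFP (pairE unE rowsE) (rawE natE) (fun q => fsts q.2) := (codeFP_fsts.comp (snd unE rowsE)).congr fun _ => rfl
  have hN : CodeFP (pairE unE rowsE) strE (fun q => LocalMap.unaryCode q.1) :=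
    (codeFP_unaryCode.comp (fst unE rowsE)).congr fun _ => rfl
  have hlenU : CodeFP (pairE unE rowsE) unE (fun q => (fsts q.2).length) := ((ulength natE).comp hf).congr fun _ => rfl
  have hM : CodeFP (pairE unE rowsE) strE (fun q => LocalMap.unaryCode (fsts q.2).length) :=
    (codeFP_unaryCode.comp hlenU).congr fun _ => rfl
  have hitem : CodeFP (pairE (pairE unE rowsE) natE) strE (fun t => blk t.1.1 (peelOut t.1.2 t.2)) :=
    (codeFP_blk.comp ((fst _ _).fst'.pair (codeFP_peelOut.comp ((fst _ _).snd'.pair (snd _ _))))).congr fun _ => rfl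
  have hbl : CodeFP (pairE unE rowsE) strE (fun q => ((fsts q.2).map fun j => blk q.1 (peelOut q.2 j)).flatten) :=
    (strFlatten.comp ((map hitem).comp ((CodeFP.id _).pair hf))).congr fun _ => rfl
  exact (strAppend.comp ((strAppend.comp (hN.pair hM)).pair hbl)).congr fun _ => rfl

/-- **The printed bits are polynomial time, relative to a polynomial-time `f₀`.** -/
theorem codeFP_outP {f₀ : List Bool → List Bool} (hf₀ : IsPolyTime f₀) :
    CodeFP (pairE unE rowsE) (rawE bitE) (fun q => outP f₀ q.1 q.2) := by
  have hF : CodeFP strE strE f₀ := of_fn f₀ ((CookBridges.isPolyTime_iff f₀).1 hf₀) fun _ => rfl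
  have hans : CodeFP (pairE unE rowsE) strE (fun q => f₀ (peelCode q.1 q.2)) := (hF.comp codeFP_peelCode).congr fun _ => rfl
  have hf : CodeFP (pairE unE rowsE) (rawE natE) (fun q => fsts q.2) := (codeFP_fsts.comp (snd unE rowsE)).congr fun _ => rfl
  have hrows : CodeFP (pairE unE rowsE) rowsE (fun q => q.2) := snd unE rowsE
  have hrange : CodeFP (pairE unE rowsE) (rawE natE) (fun q => List.range q.2.length) :=
    (urange.comp ((ulength (rawE natE)).comp hrows)).congr fun _ => rfl
  -- context σ = ((answer, fsts), rows); item j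
  have hfind : CodeFP (pairE (pairE (pairE strE (rawE natE)) rowsE) natE) natE (fun t => t.1.1.2.findIdx (· == t.2)) :=
    ((findIdxFP (σ := ℕ) (eσ := natE) (eα := natE) (p := fun q => q.2 == q.1)
      ((beq natE_injective).comp ((snd natE natE).pair (fst natE natE)))).comp
      ((snd _ _).pair (fst _ _).fst'.snd')).congr fun _ => rfl
  have hbit : CodeFP (pairE (pairE (pairE strE (rawE natE)) rowsE) natE) bitE
      (fun t => t.1.1.1.getD (t.1.1.2.findIdx (· == t.2)) false) :=
    (strGetDNat.comp ((fst _ _).fst'.fst'.pair hfind)).congr fun _ => rfl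
  have hhub : CodeFP (pairE (pairE (pairE strE (rawE natE)) rowsE) natE) bitE (fun t => !(hubOf t.1.2 t.2 == t.2)) :=
    ((beq natE_injective).comp ((codeFP_hubOf.comp ((fst _ _).snd'.pair (snd _ _))).pair (snd _ _))).not
  exact ((map (hhub.and hbit)).comp (((hans.pair hf).pair hrows).pair hrange)).congr fun _ => rfl

/-- **The pair-peeling machine is computed on codes in polynomial time.** -/
theorem codeFP_ppStr {f₀ : List Bool → List Bool} (hf₀ : IsPolyTime f₀) : CodeFP strE strE (ppStr f₀) := by
  have hrows : CodeFP strE rowsE (fun w => (decode 4 w).map Prod.snd) :=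
    ((map₀ (snd strE (rawE natE))).comp (codeFP_decode 4)).congr fun _ => rfl
  exact (bitsToStr.comp ((codeFP_outP hf₀).comp (codeFP_hdrN.pair hrows))).congr fun _ => rfl

/-- **`ppStr f₀` is polynomial-time computable** (`IsPolyTime`) whenever `f₀` is. -/
theorem isPolyTime_ppStr {f₀ : List Bool → List Bool} (hf₀ : IsPolyTime f₀) : IsPolyTime (ppStr f₀) := by
  obtain ⟨f, hf, hfw⟩ := codeFP_ppStr hf₀
  have h : f = ppStr f₀ := funext fun w => hfw w
  rw [h] at hf
  exact (CookBridges.isPolyTime_iff _).2 hf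

end PolyTime

/-! ## The support theorem -/

/-- **ROUND-18 support item «PstarPairsReduction» (notes §F4), for the record constant `C' = C₀`**: an FP
range-avoider at linear stretch for the sign-degree-≤2 `4`-local maps (`SignDeg2OnlyAvoidLinearFP 4`, constant `C₀`)
yields ONE polynomial-time function (`ppStr f₀`: hub pairing → `PstarPairPeel.peel` → `f₀` → `PstarPairPeel.lift`)
avoiding the range of every `P⋆ = x₀ ⊕ x₁ ⊕ x₂x₃` instance (`4`-local, all tables `xorAndPred`) that admits a
repeated-XOR-slot pairing (`PstarPairPeel.Pairing`) of size `C₀·n`.  Conditional, restricted-model reduction step of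
the range-avoidance ladder (cell pnp-ideate); it says nothing about `P` versus `NP`. -/
theorem pstarPairsReduction : SignDeg2Signing.SignDeg2OnlyAvoidLinearFP 4 →
    ∃ C' : ℕ, LocalAvoidLinearFP 4
      (fun n _ I => (∀ j, I.table j = xorAndPred) ∧ Nonempty (Pairing I (C' * n))) := by
  unfold SignDeg2Signing.SignDeg2OnlyAvoidLinearFP LocalAvoidLinearFP
  rintro ⟨C₀, f₀, hf₀, hspec⟩
  refine ⟨C₀, C₀, ppStr f₀, isPolyTime_ppStr hf₀, fun n m I hI hn _ => ?_⟩
  obtain ⟨hT, ⟨π⟩⟩ := hI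
  exact ppStr_correct hspec I hT π le_rfl hn

end Summit.PneNP.PneNP.Theorems.PstarPairPeelFP
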